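import Summits.BirchSwinnertonDyer.BirchSwinnertonDyer.Theorems.TwoAdicConverseEulerFactorAtTwo
import HarnessLib

/-!
# Route `TwoAdicConverse` (rung S3), crux `OrdLambdaHalfAtTwo` (item 19556): Greenberg–Vatsal's Euler-factor
# elements `𝒫_ℓ(T) ∈ ℤ₂⟦T⟧` at `p = 2` on the `E[2]`-IRREDUCIBLE habitat — `a_ℓ` odd ⇒ `d_ℓ = 0`, `𝒫_ℓ mod 2` a unit

Cell `bsd-2adic` (run/shared/lean/pub/bsd-2adic/), seat `bsd-2adic-conv-1` (GEN 7). THEOREMS ONLY — no named fact, no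
axiom, no definition, nothing conditional; the companion of GEN 5's `TwoAdicConverseEulerFactorAtTwo` (p459396), which
did the reducible habitat (`a_ℓ` even: `λ(𝒫_ℓ) = 2^{n_ℓ+1}`), the multiplicative (`2^{n_ℓ}`) and additive (`0`) places.
Here the remaining case: at a GOOD odd prime with `a_ℓ` ODD — on the `E[2]`-irreducible habitat of stub_surj this is
"`Frob_ℓ` has order `3` on `E[2]`", i.e. the `2`-division cubic is irreducible mod `ℓ` — `P̃_ℓ = X² + X + 1 ∈ 𝔽₂[X]` has
no root, `d_ℓ = 0`, and `𝒫_ℓ mod 2` is a unit: depleting the `2`-adic `L`-function at such a prime does not move `λ`.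
With GEN 5's §3–§4 this completes the local terms of the `λ`-shift law `λ(b·∏_{ℓ∈Σ₀}𝒫_ℓ) = λ(b) + Σ 2^{n_ℓ} d_ℓ`
(`lam_mul_eulerFactorProduct_two`) — Emerton–Pollack–Weston's `e_ℓ` at `p = 2` (their Theorem 2 is printed for ODD `p`
and `p`-DISTINGUISHED `ρ̄` only; at `p = 2` nothing is claimed here beyond the local bookkeeping).
HONEST FRAMING: bookkeeping only; nothing here compares two curves; item 19556 / Kato's IMC at `2` stay OPEN class-wide;
BSD is not proved by any of this. PARTITION (D-0054): none — RANK axis (S3); companion cell X5@2 good-ord (B1·O1), the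
E[2]-irreducible block.

References: R. Greenberg, V. Vatsal, Invent. Math. 142 (2000), §2 Prop. (2.4) (p. 22) [GreenbergVatsal2000]; M. Emerton,
R. Pollack, T. Weston, Invent. Math. 163 (2006), §1 Theorem 2 (the local terms `e_ℓ`) [EmertonPollackWeston2006];
J. H. Silverman, GTM 106 (2009), C.§16 [SilvermanAEC2009].
-/

set_option linter.dupNamespace false
set_option autoImplicit false

noncomputable section

open scoped Classical

open Polynomial NumberField IsDedekindDomain WeierstrassCurve Literature.NumberTheory.EllipticCurves
  Literature.NumberTheory.EllipticCurves.GreenbergVatsal2000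
  Summit.BirchSwinnertonDyer.Rank1Residual.X1.MuLambda
  Summit.BirchSwinnertonDyer.Rank1Residual.X2.EulerFactorAlgebra
  Summit.BirchSwinnertonDyer.Rank1Residual.X2.EulerFactorInvariants

namespace Summit.BirchSwinnertonDyer.BirchSwinnertonDyer.Theorems.TwoAdicTwistConverse

/-! ## §1. `a_ℓ` odd ⇒ `d_ℓ = 0`, `𝒫_ℓ mod 2` is a unit

On the `E[2]`-IRREDUCIBLE habitat `a_ℓ` is odd exactly when `Frob_ℓ` acts on `E[2] ≅ 𝔽₂²`
with order `3` (trace `1` in `GL₂(𝔽₂) ≅ S₃`), i.e. when the `2`-division cubic is irreducible mod `ℓ`; at such a good odd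
prime `P̃_ℓ = 1 − X + X² = X² + X + 1` has no root in `𝔽₂`, so `d_ℓ = 0` and `𝒫_ℓ mod 2` is a UNIT of `𝔽₂⟦T⟧`:
depleting the `2`-adic `L`-function at such a prime does not move `λ`. Together with §3 this completes the case table of
`ord_T(𝒫_ℓ mod 2)` at every odd place: good `a_ℓ` odd `0` · good `a_ℓ` even `2^{n_ℓ+1}` · multiplicative `2^{n_ℓ}` ·
additive `0` — the local terms of the `λ`-shift law `λ(b·∏𝒫_ℓ) = λ(b) + Σ 2^{n_ℓ} d_ℓ` (`lam_mul_eulerFactorProduct_two`)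
by which the `μ`-normalised `Σ₀`-depleted `2`-adic `L`-functions of two curves with isomorphic `E[2]` are compared
(Emerton–Pollack–Weston's `e_ℓ` at `p = 2`; their Theorem 2 is printed for odd `p` and `p`-distinguished `ρ̄` only).
HONEST: bookkeeping only; nothing here compares two curves; item 19556 stays OPEN. -/

section OddTrace

variable (W : WeierstrassCurve ℚ) (v : HeightOneSpectrum (𝓞 ℚ))

/-- **Good odd `ℓ` with `a_ℓ` odd: `P̃_ℓ = 1 − ã_ℓ X + ℓ̃ X² = X² + X + 1` in `𝔽₂[X]`** (the `E[2]`-irreducible habitat: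
`Frob_ℓ` of order `3` on `E[2]`). [cite: SilvermanAEC2009, C.§16] [cite: EmertonPollackWeston2006, §1 Thm. 2 (the local terms e_ℓ)] -/
theorem eulerFactorModP_two_of_hasGoodReductionAt_of_odd (hv : W.HasGoodReductionAt v)
    (hℓ : Rat.HeightOneSpectrum.natGenerator v ≠ 2) (ha : Odd (W.frobeniusTraceAt v)) :
    eulerFactorModP W 2 v = X ^ 2 + X + 1 := by
  obtain ⟨hcop, -⟩ := coprime_natGenerator v (p := 2) hℓ
  have hq : Int.castRingHom (ZMod 2) (Nat.card (IsLocalRing.ResidueField (v.adicCompletionIntegers ℚ)) : ℤ) = 1 := by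
    rw [eq_intCast, natCard_residueField_adicCompletionIntegers, Int.cast_natCast]
    exact ZMod.natCast_eq_one_iff_odd.mpr (Nat.coprime_two_left.mp hcop)
  have hak : Int.castRingHom (ZMod 2) (W.frobeniusTraceAt v) = 1 := by
    rw [eq_intCast]
    exact ZMod.intCast_eq_one_iff_odd.mpr ha
  rw [eulerFactorModP, localPolynomialAt_of_hasGoodReductionAt hv, Polynomial.map_add, Polynomial.map_sub,
    Polynomial.map_one, Polynomial.map_mul, Polynomial.map_mul, Polynomial.map_C, Polynomial.map_C, hak, hq,
    Polynomial.map_pow, Polynomial.map_X, map_one, one_mul, one_mul]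
  have h2 : (2 : (ZMod 2)[X]) = 0 := by simpa using CharP.cast_eq_zero (ZMod 2)[X] 2
  linear_combination (-X : (ZMod 2)[X]) * h2

/-- `X² + X + 1` does not vanish at `1 ∈ 𝔽₂` (`1 + 1 + 1 = 1`). [folklore] -/
theorem not_isRoot_X_sq_add_X_add_one_zmod_two : ¬ (X ^ 2 + X + 1 : (ZMod 2)[X]).IsRoot 1 := by
  rw [IsRoot.def, eval_add, eval_add, eval_pow, eval_X, eval_one]
  decide

/-- **`d_ℓ = 0`** at a good odd `ℓ` with `a_ℓ` odd: `ℓ̃⁻¹ = 1` is not a root of `P̃_ℓ = X² + X + 1`.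
[cite: GreenbergVatsal2000, §2 Prop. (2.4) (p. 22)] [cite: EmertonPollackWeston2006, §1 Thm. 2] -/
theorem dMultiplicity_two_of_hasGoodReductionAt_of_odd (hv : W.HasGoodReductionAt v)
    (hℓ : Rat.HeightOneSpectrum.natGenerator v ≠ 2) (ha : Odd (W.frobeniusTraceAt v)) :
    dMultiplicity W 2 v = 0 := by
  obtain ⟨hcop, -⟩ := coprime_natGenerator v (p := 2) hℓ
  rw [dMultiplicity, eulerFactorModP_two_of_hasGoodReductionAt_of_odd W v hv hℓ ha, inv_natCast_zmod_two_eq_one hcop]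
  exact Polynomial.rootMultiplicity_eq_zero not_isRoot_X_sq_add_X_add_one_zmod_two

/-- **`λ(𝒫_ℓ) = 0` at a GOOD odd prime `ℓ` with `a_ℓ` odd: `𝒫_ℓ mod 2` is a unit of `𝔽₂⟦T⟧`** (`d_ℓ = 0`; any `E/ℚ`).
[cite: GreenbergVatsal2000, §2 Prop. (2.4) (p. 22)] [cite: EmertonPollackWeston2006, §1 Thm. 2] -/
theorem order_map_toZMod_eulerFactorElement_two_of_good_odd (hv : W.HasGoodReductionAt v)
    (hℓ : Rat.HeightOneSpectrum.natGenerator v ≠ 2) (ha : Odd (W.frobeniusTraceAt v)) :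
    (PowerSeries.map (PadicInt.toZMod (p := 2)) (eulerFactorElement W 2 v)).order = 0 := by
  rw [order_map_toZMod_eulerFactorElement_two W v hℓ, dMultiplicity_two_of_hasGoodReductionAt_of_odd W v hv hℓ ha,
    mul_zero, Nat.cast_zero]

/-- The constant term of `𝒫_ℓ mod 2` is a UNIT at a good odd `ℓ` with `a_ℓ` odd (order `0` read as a coefficient).
[cite: GreenbergVatsal2000, §2 Prop. (2.4) (p. 22)] -/
theorem isUnit_constantCoeff_map_toZMod_eulerFactorElement_two_of_good_odd (hv : W.HasGoodReductionAt v)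
    (hℓ : Rat.HeightOneSpectrum.natGenerator v ≠ 2) (ha : Odd (W.frobeniusTraceAt v)) :
    IsUnit (PowerSeries.constantCoeff (PowerSeries.map (PadicInt.toZMod (p := 2)) (eulerFactorElement W 2 v))) := by
  have h0 := order_map_toZMod_eulerFactorElement_two_of_good_odd W v hv hℓ ha
  rw [← PowerSeries.coeff_zero_eq_constantCoeff_apply, isUnit_iff_ne_zero]
  intro hc
  have hle : (1 : ℕ∞) ≤ (PowerSeries.map (PadicInt.toZMod (p := 2)) (eulerFactorElement W 2 v)).order := by
    refine PowerSeries.nat_le_order _ 1 (fun i hi => ?_)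
    obtain rfl : i = 0 := Nat.lt_one_iff.mp hi
    exact hc
  rw [h0] at hle
  exact absurd hle (by decide)

/-- **The complete case table at a GOOD odd prime: `ord_T(𝒫_ℓ mod 2) = 0` if `a_ℓ` is odd, `2^{n_ℓ+1}` if `a_ℓ` is even.**
[cite: GreenbergVatsal2000, §2 Prop. (2.4) (p. 22)] [cite: EmertonPollackWeston2006, §1 Thm. 2] -/
theorem order_map_toZMod_eulerFactorElement_two_of_good_by_parity (hv : W.HasGoodReductionAt v)
    (hℓ : Rat.HeightOneSpectrum.natGenerator v ≠ 2) :
    (PowerSeries.map (PadicInt.toZMod (p := 2)) (eulerFactorElement W 2 v)).order =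
      if Even (W.frobeniusTraceAt v) then
        (((2 ^ (padicValNat 2 ((Rat.HeightOneSpectrum.natGenerator v ^ 2 - 1) / 8) + 1) : ℕ) : ℕ∞)) else 0 := by
  split_ifs with ha
  · rw [order_map_toZMod_eulerFactorElement_two W v hℓ, dMultiplicity_two_of_hasGoodReductionAt_of_even W v hv hℓ ha,
      ← pow_succ]
  · exact order_map_toZMod_eulerFactorElement_two_of_good_odd W v hv hℓ (Int.not_even_iff_odd.mp ha)

end OddTrace

end Summit.BirchSwinnertonDyer.BirchSwinnertonDyer.Theorems.TwoAdicTwistConverse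

end
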